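import Literature.Computability.AlgebraicComplexity.GCT
import Literature.Computability.AlgebraicComplexity.OrbitClosureProofs
import Literature.Computability.AlgebraicComplexity.DeterminantalComplexityProofs
import HarnessLib

/-!
# GCT: discharges of the consequences of the Mulmuley–Sohoni conjecture

Sibling proofs file of `Literature/Computability/AlgebraicComplexity/GCT.lean`.

`Literature.Computability.AlgebraicComplexity.MulmuleySohoniConjecture` itself (Mulmuley–Sohoni 2001, Conj. 4.3) is an **open
conjecture** and is *not* asserted anywhere. This file discharges the two named facts of
`GCT.lean` that record its standard *consequences*:

* `Literature.Computability.AlgebraicComplexity.borderDcPerSuperpolynomial_of_mulmuleySohoni_holds`: Conj. 4.3 implies that the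
  border determinantal complexity of the permanent is not polynomially bounded
  (`Literature.Computability.AlgebraicComplexity.BorderDcPerSuperpolynomial`, the "infinitely often" form in which
  Bürgisser–Ikenmeyer–Panova 2019, §1, Conj. 2 and Bürgisser–Landsberg–Manivel–Weyman 2011,
  Conj. 1.1 render the Mulmuley–Sohoni conjecture). Pure arithmetic: `n ^ c + c ≤ n ^ (c + 1)`
  for `n ≥ 2`.
* `Literature.Computability.AlgebraicComplexity.dcPerSuperpolynomial_of_mulmuleySohoni_holds`: Conj. 4.3 implies pnp.S05 over `ℂ`
  (`Literature.PNP.DcPerSuperpolynomial ℂ`: the affine determinantal complexity `dc(per_n)` is not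
  polynomially bounded), via Mulmuley–Sohoni 2001, Prop. 4.4
  (`Literature.Computability.AlgebraicComplexity.paddedPerPoly_mem_orbitClosure_detPoly_of_hasDetRepr_holds`: a determinantal
  representation of `per_n` of size `m ≥ n` puts `ℓ ^ (m - n) per_n` in `\overline{GL · det_m}`)
  together with the attainment of `dc` (`Literature.Computability.AlgebraicComplexity.hasDetRepr_determinantalComplexity_holds`,
  resting on Valiant universality `Literature.Computability.AlgebraicComplexity.exists_hasDetRepr_holds`) and padding
  (`Literature.Computability.AlgebraicComplexity.HasDetRepr.mono_holds`) to a size `m = max (dc per_n) n ≥ n`.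

## Sources

* K. Mulmuley, M. Sohoni, *Geometric complexity theory I: an approach to the P vs. NP and
  related problems*, SIAM J. Comput. 31 (2001) 496–526, §4, Conj. 4.3, Prop. 4.4
  (key `MulmuleySohoniSIAM2001`; `MulmuleySohoni2001` is the interim stub key of the same paper
  used by the docstrings of `GCT.lean`).
* P. Bürgisser, C. Ikenmeyer, G. Panova, *No occurrence obstructions in geometric complexity
  theory*, J. AMS 32 (2019) = arXiv:1604.06431, §1, Conj. 1–2 and the paragraph following
  Conj. 2 ("`dc(per_m) ≤ n` implies `X_{11}^{n-m} per_m ∈ \overline{GL_{n²} det_n}`").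
* P. Bürgisser, J. M. Landsberg, L. Manivel, J. Weyman, *An overview of mathematical issues
  arising in the geometric complexity theory approach to VP ≠ VNP*, SIAM J. Comput. 40 (2011)
  = arXiv:0907.2850, §1, Conj. 1.1.
-/

namespace Literature.Computability.AlgebraicComplexity

/-! ### Arithmetic -/

/-- For `2 ≤ n` one has `n ^ c + c ≤ n ^ (c + 1)` (since `c < 2 ^ c ≤ n ^ c` and
`2 n ^ c ≤ n · n ^ c`). [folklore] -/
theorem pow_add_self_le_pow_succ {n : ℕ} (hn : 2 ≤ n) (c : ℕ) : n ^ c + c ≤ n ^ (c + 1) := by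
  have h1 : c < 2 ^ c := Nat.lt_two_pow_self
  have h2 : 2 ^ c ≤ n ^ c := Nat.pow_le_pow_left hn c
  calc n ^ c + c ≤ n ^ c + n ^ c := by omega
    _ = 2 * n ^ c := by ring
    _ ≤ n * n ^ c := Nat.mul_le_mul_right _ hn
    _ = n ^ (c + 1) := by ring

/-! ### The border form follows from Conj. 4.3 -/

/-- **Discharge of `borderDcPerSuperpolynomial_of_mulmuleySohoni`.** The Mulmuley–Sohoni
conjecture (Mulmuley–Sohoni 2001, Conj. 4.3: for every `c`, for all large `n` and all `m` with
`n ≤ m ≤ n ^ c`, `ℓ ^ (m - n) per_n ∉ \overline{GL_{m²} · det_m}`) implies that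
`\underline{dc}(per_n)` is not polynomially bounded: a bound `n ≤ m ≤ n ^ c + c` with
`ℓ ^ (m - n) per_n ∈ \overline{GL_{m²} · det_m}` for every `n` contradicts Conj. 4.3 with
exponent `c + 1` at `n = max n₀ 2`, because `n ^ c + c ≤ n ^ (c + 1)` for `n ≥ 2`.
Bürgisser–Ikenmeyer–Panova 2019, §1 (Conj. 2); Bürgisser–Landsberg–Manivel–Weyman 2011, §1
(Conj. 1.1). [cite: MulmuleySohoniSIAM2001, Conj. 4.3] -/
theorem borderDcPerSuperpolynomial_of_mulmuleySohoni_holds :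
    borderDcPerSuperpolynomial_of_mulmuleySohoni := by
  rintro hMS ⟨c, hc⟩
  obtain ⟨n₀, hn₀⟩ := hMS (c + 1)
  obtain ⟨m, hm, hnm, hmle, hrepr⟩ := hc (max n₀ 2)
  exact hn₀ (max n₀ 2) (le_max_left _ _) m hnm
    (hmle.trans (pow_add_self_le_pow_succ (le_max_right _ _) c)) hrepr

/-! ### The affine form (pnp.S05 over `ℂ`) follows from Conj. 4.3 via Prop. 4.4 -/

/-- **Discharge of `dcPerSuperpolynomial_of_mulmuleySohoni`** (Mulmuley–Sohoni 2001, Prop. 4.4,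
consequence). Suppose `dc(per_n) ≤ n ^ c + c` for all `n`, and let `n₀` be the threshold of
Conj. 4.3 for the exponent `c + 1`; put `n = max n₀ 2`. The infimum `dc(per_n)` is attained
(`Literature.Computability.AlgebraicComplexity.hasDetRepr_determinantalComplexity_holds`, from Valiant universality), so padding
(`Literature.Computability.AlgebraicComplexity.HasDetRepr.mono_holds`) gives an affine determinantal representation of `per_n`
of size `m = max (dc per_n) n`, with `n ≤ m ≤ n ^ (c + 1)` (`n ^ c + c ≤ n ^ (c + 1)` and
`n ≤ n ^ (c + 1)` for `n ≥ 2`). By Prop. 4.4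
(`Literature.Computability.AlgebraicComplexity.paddedPerPoly_mem_orbitClosure_detPoly_of_hasDetRepr_holds`, `ℂ` infinite)
`ℓ ^ (m - n) per_n ∈ \overline{GL_{m²} · det_m}`, contradicting Conj. 4.3. (The Mignon–Ressayre
bound `dc(per_n) ≥ n` mentioned in the fact's docstring is not needed: padding to `max (dc) n`
suffices.) Mulmuley–Sohoni 2001, Prop. 4.4; Bürgisser–Landsberg–Manivel–Weyman 2011, §2;
Bürgisser–Ikenmeyer–Panova 2019, §1 (paragraph after Conj. 2).
[cite: MulmuleySohoniSIAM2001, Prop. 4.4] -/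
theorem dcPerSuperpolynomial_of_mulmuleySohoni_holds :
    dcPerSuperpolynomial_of_mulmuleySohoni := by
  rintro hMS ⟨c, hc⟩
  obtain ⟨n₀, hn₀⟩ := hMS (c + 1)
  have hn2 : 2 ≤ max n₀ 2 := le_max_right _ _
  -- the attained representation of size `dc(per_n)`, padded to size `m = max (dc per_n) n`
  have hd : Literature.Computability.AlgebraicComplexity.HasDetRepr (Literature.Computability.AlgebraicComplexity.perPoly (Fin (max n₀ 2)) ℂ)
      (Literature.Computability.AlgebraicComplexity.determinantalComplexity (Literature.Computability.AlgebraicComplexity.perPoly (Fin (max n₀ 2)) ℂ)) :=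
    Literature.Computability.AlgebraicComplexity.hasDetRepr_determinantalComplexity_holds _
  have hrepr : Literature.Computability.AlgebraicComplexity.HasDetRepr (Literature.Computability.AlgebraicComplexity.perPoly (Fin (max n₀ 2)) ℂ)
      (max (Literature.Computability.AlgebraicComplexity.determinantalComplexity (Literature.Computability.AlgebraicComplexity.perPoly (Fin (max n₀ 2)) ℂ))
        (max n₀ 2)) :=
    Literature.Computability.AlgebraicComplexity.HasDetRepr.mono_holds hd (le_max_left _ _)
  have hnm : max n₀ 2 ≤ max (Literature.Computability.AlgebraicComplexity.determinantalComplexity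
      (Literature.Computability.AlgebraicComplexity.perPoly (Fin (max n₀ 2)) ℂ)) (max n₀ 2) := le_max_right _ _
  have hmle : max (Literature.Computability.AlgebraicComplexity.determinantalComplexity
      (Literature.Computability.AlgebraicComplexity.perPoly (Fin (max n₀ 2)) ℂ)) (max n₀ 2) ≤ (max n₀ 2) ^ (c + 1) :=
    max_le ((hc _).trans (pow_add_self_le_pow_succ hn2 c))
      (le_self_pow₀ (by omega) (Nat.succ_ne_zero c))
  haveI : NeZero (max (Literature.Computability.AlgebraicComplexity.determinantalComplexity
      (Literature.Computability.AlgebraicComplexity.perPoly (Fin (max n₀ 2)) ℂ)) (max n₀ 2)) := ⟨by omega⟩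
  exact hn₀ (max n₀ 2) (le_max_left _ _) _ hnm hmle
    (Literature.Computability.AlgebraicComplexity.paddedPerPoly_mem_orbitClosure_detPoly_of_hasDetRepr_holds hrepr hnm)

end Literature.Computability.AlgebraicComplexity

/-! ## Appendix (2026-08-15): two readings of `BorderDcPerSuperpolynomial`

`Literature.Computability.AlgebraicComplexity.BorderDcPerSuperpolynomial` ("the border
determinantal complexity of the permanent over `ℂ` is not polynomially bounded") is an **open
conjecture** — the Mulmuley–Sohoni strengthening of Valiant's hypothesis, printed in this
"no constant `c`" / "infinitely often" form as Bürgisser–Landsberg–Manivel–Weyman 2011, Conj. 1.1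
and Bürgisser–Ikenmeyer–Panova 2019, §1 Conj. 2, and as "`\overline{dc}(perm_m)` grows faster
than any polynomial" in Landsberg 2017, Conj. 1.2.5.2; by Bürgisser–Landsberg–Manivel–Weyman 2011,
Prop. 9.2 it is equivalent to `VNP ⊄ \overline{VP_ws}`, and the best lower bound known is
`\underline{dc}(per_m) ≥ m² / 2` (Landsberg 2017, Thm. 6.5.2.3, after Landsberg–Manivel–Ressayre).
It is therefore *not* discharged here (no `_holds`). This appendix only records (with complete proofs) the
two equivalent readings of the vendored statement:

* `borderDcPerSuperpolynomial_iff`: the `∀ c, ∃ n, ∀ m ∈ [n, n ^ c + c], ℓ ^ (m - n) per_n ∉ Δ[det_m]`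
  form (negation pushed through the quantifiers);
* `borderDcPerSuperpolynomial_iff_not_isPBounded`: equivalence with
  `¬ IsPBounded (borderDetComplexityPer ℂ)`, i.e. with "`n ↦ \underline{dc}(per_n)` is not
  p-bounded" for the prelude's complexity measure
  `borderDetComplexityPer k n = sInf {m | 0 < m ∧ n ≤ m ∧ HasBorderDetRepr k n m}` (which carries the
  side condition `n ≤ m`, so no junk intervenes); the direction "p-bounded `⇒` representations in
  the window" uses that this infimum is attained over `ℂ` (its defining set is nonempty by
  Valiant universality and Mulmuley–Sohoni 2001, Prop. 4.4, as in
  `hasBorderDetRepr_borderDetComplexityPer` of `OrbitClosureProofs.lean`).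

Sources: P. Bürgisser, J. M. Landsberg, L. Manivel, J. Weyman, SIAM J. Comput. 40 (2011)
= arXiv:0907.2850, §1 Conj. 1.1 and §9 Prop. 9.2 (key `BurgisserLandsbergManivelWeymanSIAM2011`);
P. Bürgisser, C. Ikenmeyer, G. Panova, J. AMS 32 (2019) = arXiv:1604.06431, §1 Conj. 1–2
(key `BurgisserIkenmeyerPanovaJAMS2019`); J. M. Landsberg, *Geometry and Complexity Theory*,
CUP 2017, Def. 1.2.5.1, Conj. 1.2.5.2, Thm. 6.5.2.3 (key `LandsbergGCT2017`).
-/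

namespace Literature.Computability.AlgebraicComplexity

section BorderReadings

/-- `BorderDcPerSuperpolynomial` with the negation pushed through: for every exponent `c` there
is an `n` such that no size `m` in the window `n ≤ m ≤ n ^ c + c` has
`ℓ ^ (m - n) per_n ∈ \overline{GL_{m²} · det_m}` — the "for all `c ≥ 1` … for infinitely many
`m`" shape of Bürgisser–Ikenmeyer–Panova 2019, §1 Conj. 2 / Bürgisser–Landsberg–Manivel–Weyman
2011, Conj. 1.1 (there with the single size `m ↦ m ^ c`). Pure logic.
[cite: BurgisserLandsbergManivelWeymanSIAM2011, Conj. 1.1] -/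
theorem borderDcPerSuperpolynomial_iff :
    BorderDcPerSuperpolynomial ↔ ∀ c : ℕ, ∃ n : ℕ, ∀ (m : ℕ) [NeZero m],
      n ≤ m → m ≤ n ^ c + c → ¬ HasBorderDetRepr ℂ n m := by
  refine ⟨fun h c => ?_, fun h hex => ?_⟩
  · by_contra hc
    refine h ⟨c, fun n => ?_⟩
    by_contra hn
    exact hc ⟨n, fun m _ hnm hmle hrepr => hn ⟨m, ‹NeZero m›, hnm, hmle, hrepr⟩⟩
  · obtain ⟨c, hc⟩ := hex
    obtain ⟨n, hn⟩ := h c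
    obtain ⟨m, hm, hnm, hmle, hrepr⟩ := hc n
    exact @hn m hm hnm hmle hrepr

/-- `BorderDcPerSuperpolynomial` is equivalent to "`n ↦ \underline{dc}(per_n)` is not p-bounded"
for the prelude's border determinantal complexity
`borderDetComplexityPer ℂ n = sInf {m | 0 < m ∧ n ≤ m ∧ ℓ ^ (m - n) per_n ∈ Δ[det_m]}`
(Landsberg 2017, Def. 1.2.5.1 and Conj. 1.2.5.2; Bürgisser 2000, Def. 2.1(1) for p-bounded).
If some window `n ≤ m ≤ n ^ c + c` always contains a size `m` with a border representation then
`\underline{dc}(per_n) ≤ m ≤ n ^ c + c` (`Nat.sInf_le`); conversely a bound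
`\underline{dc}(per_n) ≤ n ^ c + c` yields such an `m`, namely `\underline{dc}(per_n)` itself,
because over `ℂ` the infimum is attained with `0 < m` and `n ≤ m` (the defining set is
nonempty: Valiant universality `exists_hasDetRepr_holds`, padding `HasDetRepr.mono_holds`, and
Mulmuley–Sohoni 2001, Prop. 4.4 `paddedPerPoly_mem_orbitClosure_detPoly_of_hasDetRepr_holds`; the
argument of `hasBorderDetRepr_borderDetComplexityPer` in `OrbitClosureProofs.lean`).
[cite: LandsbergGCT2017, Conj. 1.2.5.2] -/
theorem borderDcPerSuperpolynomial_iff_not_isPBounded :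
    BorderDcPerSuperpolynomial ↔ ¬ IsPBounded (borderDetComplexityPer ℂ) := by
  refine not_congr ⟨?_, ?_⟩
  · rintro ⟨c, hc⟩
    refine ⟨c, fun n => ?_⟩
    obtain ⟨m, hm, hnm, hmle, hrepr⟩ := hc n
    have hdc : borderDetComplexityPer ℂ n ≤ m :=
      Nat.sInf_le ⟨Nat.pos_of_ne_zero (NeZero.ne m), hnm, hrepr⟩
    exact hdc.trans hmle
  · rintro ⟨c, hc⟩
    refine ⟨c, fun n => ?_⟩
    -- the infimum defining `borderDetComplexityPer ℂ n` is attained: its defining set is nonempty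
    -- (Valiant universality, padding to size `max m₀ (n + 1)`, Mulmuley–Sohoni 2001 Prop. 4.4),
    -- the argument of `hasBorderDetRepr_borderDetComplexityPer` (`OrbitClosureProofs.lean`)
    have hne : {m : ℕ | ∃ h : 0 < m, n ≤ m ∧
        (haveI := NeZero.of_pos h; HasBorderDetRepr ℂ n m)}.Nonempty := by
      obtain ⟨m₀, hm₀⟩ := exists_hasDetRepr_holds (perPoly (Fin n) ℂ)
      refine ⟨max m₀ (n + 1), by omega, by omega, ?_⟩
      haveI : NeZero (max m₀ (n + 1)) := NeZero.of_pos (by omega)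
      exact paddedPerPoly_mem_orbitClosure_detPoly_of_hasDetRepr_holds
        (HasDetRepr.mono_holds hm₀ (le_max_left _ _)) (by omega)
    obtain ⟨hpos, hle, hrepr⟩ := Nat.sInf_mem hne
    exact ⟨borderDetComplexityPer ℂ n, NeZero.of_pos hpos, hle, hc n, hrepr⟩

end BorderReadings

end Literature.Computability.AlgebraicComplexity
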